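import Mathlib.Topology.Algebra.Category.ProfiniteGrp.Basic
import Mathlib.GroupTheory.Commensurable
import Mathlib.GroupTheory.Index
import Mathlib.Algebra.Group.Subgroup.Pointwise
import Literature.AnabelianGeometry.AbsoluteAnabelian.ProfiniteTerminology
import Literature.AnabelianGeometry.AbsoluteAnabelian.AbsTopII.DecompositionGroups
import Literature.AnabelianGeometry.Anabelioids.ProSigma

/-!
# [AbsTopII] Prop 1.3, the remaining clauses: (i), (ii), (iii) (rest), (v) (middle), (viii), (x)

S. Mochizuki, *Topics in Absolute Anabelian Geometry II* [AbsTopII], §1 "A Combinatorial Analogue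
of Stable Polycurves", Proposition 1.3 "Basic Properties of Inertia and Decomposition Groups",
pp. 11–12, with Example 1.1 (iii) p. 9 (the `Σ`-index `i^Σ_e` of a node) and Def 1.2 (ii) p. 10.
Page locators are the PDF pages of the author's manuscript (lit key `paper:url-585b8d0ad0d9`,
76 pp.); bib key `MochizukiAbsTopII2013`.  Census nodes typed here: AbsTopII:Prop1.3(i), (ii),
(viii), (x), and the clauses of (iii), (v) left out of `AbsTopII/DecompositionGroups.lean`.

This file is ADDITIVE over abc-iut-L4-t4's `DPSCData` (`AbsTopII/DecompositionGroups.lean`,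
p404475: the DPSC-extension `Π_𝔾 ⊆ Π_I ⊆ Π_H` with verticial / edge-like subgroups and the REAL
definitions `Dv, Iv, DvNode, IvNode, DvCusp, IvCusp`; Prop 1.3 (iii) first clause, (iv), (v) outer
clauses, (vi), (vii), (ix) typed there) — nothing of it is re-declared.  As there, every item is a
PREDICATE on the abstract data (it holds for data arising from a stable log curve over a log
point; no model-relative comparison is asserted).  Additional data needed by the remaining clauses
and NOT derivable from `DPSCData`: the set of primes `Σ` and the `Σ`-indices `i^Σ_e` of the nodes
(Example 1.1 (iii)) — `DPSCIndexData`; the log points `τ_S ∈ X^{log}(S^{log})` of (x) with the kind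
of their image — `LogPointData`.

"`≅ Ẑ^Σ` as abstract profinite groups" is typed intrinsically (as abc-iut-L4-t1's
`IsFreeProcyclic` for `Ẑ`): topologically generated by one element, and the indices of open
subgroups are exactly the `Σ`-integers (`IsFreeProSigmaCyclic`); "`≅ Ẑ^Σ × Ẑ^Σ`" as an internal
direct product of two such closed subgroups (`IsInternalProduct`).  "[for appropriate choices of
conjugates of the various inertia and decomposition groups involved]" is rendered by explicit
`Π_H`-conjugates `MulAut.conj g • _`.
Deliberately NOT typed: the word "natural" in "natural isomorphism / natural exact sequence"
(only the group-theoretic content: kernels, images, indices); the first sentence of (x) defining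
`τ_I` by functoriality (the section is taken as a datum).
HONEST FRAMING: typed ≠ discharged; nothing here takes a side on [IUTchIII] Cor 3.12.
-/

open scoped Pointwise

universe u

namespace Literature.AnabelianGeometry.AbsoluteAnabelian.AbsTopII

open Literature.AnabelianGeometry.Anabelioids (IsSigmaInteger)

/-! ### `Ẑ^Σ` and `Ẑ^Σ × Ẑ^Σ`, intrinsically -/

/-- "as abstract profinite groups, `≅ Ẑ^Σ`" (Prop 1.3 (i) p. 11; `Ẑ^Σ` = "the maximal pro-`Σ`
quotient of `Ẑ`", Ex 1.1 (i) p. 8), typed intrinsically for a topological group: some cyclic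
subgroup is dense, and a natural number is the index of an open subgroup iff it is a `Σ`-integer.
[cite: MochizukiAbsTopII2013, Prop 1.3 (i) p.11] -/
@[mk_iff] structure IsFreeProSigmaCyclic (S : Set ℕ) (G : Type u) [Group G] [TopologicalSpace G] :
    Prop where
  /-- topologically generated by one element -/
  exists_dense_zpowers : ∃ g : G, Dense (Subgroup.zpowers g : Set G)
  /-- the indices of open subgroups are exactly the `Σ`-integers -/
  isOpen_index_iff : ∀ n : ℕ, (∃ H : Subgroup G, IsOpen (H : Set G) ∧ H.index = n) ↔ IsSigmaInteger S n

/-- `K` is the internal direct product of its subgroups `A`, `B` ("the natural morphism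
`A × B → K` is an isomorphism", Prop 1.3 (ii)/(iii)): `A, B ≤ K` commute elementwise, meet
trivially and generate `K`. [cite: MochizukiAbsTopII2013, Prop 1.3 (iii) p.11] -/
@[mk_iff] structure IsInternalProduct {G : Type u} [Group G] (A B K : Subgroup G) : Prop where
  /-- `A ≤ K` -/
  left_le : A ≤ K
  /-- `B ≤ K` -/
  right_le : B ≤ K
  /-- `A` and `B` commute -/
  commute : ∀ a ∈ A, ∀ b ∈ B, a * b = b * a
  /-- `A ∩ B = 1` (injectivity of `A × B → K`) -/
  inf_eq_bot : A ⊓ B = ⊥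
  /-- `A · B = K` (surjectivity of `A × B → K`) -/
  sup_eq : A ⊔ B = K

/-! ### The `Σ`-indices of the nodes (Example 1.1 (iii)) -/

/-- DPSC data together with the set of primes `Σ` and, for each node `e`, its `Σ`-index: "the
largest positive integer `j` such that `i_e/j` is a product of primes `∉ Σ`" where `ξ + η = i_e · σ`
in the stalk `M_e` of the characteristic sheaf (Ex 1.1 (iii) p. 9) — a datum of the construction
data, recovered group-theoretically by Prop 1.3 (ii). [cite: MochizukiAbsTopII2013, Ex 1.1 (iii) p.9] -/
structure DPSCIndexData extends DPSCData.{u} where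
  /-- the nonempty set of primes `Σ` -/
  Sigma : Set ℕ
  /-- `Σ` is a nonempty set of primes -/
  sigma_prime : Sigma.Nonempty ∧ ∀ p ∈ Sigma, p.Prime
  /-- the `Σ`-index `i^Σ_e ≥ 1` of the node `e` -/
  sigmaIndex : Node → ℕ
  /-- `i^Σ_e` is a positive integer (indeed a `Σ`-integer) -/
  sigmaIndex_isSigmaInteger : ∀ e, IsSigmaInteger Sigma (sigmaIndex e)

namespace DPSCIndexData

variable (X : DPSCIndexData.{u})

/-- **Prop 1.3 (i)** p. 11: "If `e` is a cusp of `𝔾`, then as abstract profinite groups,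
`I_e ≅ Ẑ^Σ`." [cite: MochizukiAbsTopII2013, Prop 1.3 (i) p.11] -/
def Prop_1_3_i : Prop := ∀ e : X.Cusp, IsFreeProSigmaCyclic X.Sigma ↥(X.IvCusp e)

/-- **Prop 1.3 (ii)** p. 11 (node `e`): "we have a natural exact sequence `1 → Π_e → I_e → I → 1`"
— `Π_e ≤ I_e`, `I_e ∩ Π_𝔾 = Π_e` (kernel of `I_e → I = Π_I/Π_𝔾`) and `I_e · Π_𝔾 = Π_I` (`I_e ↠ I`);
"as abstract profinite groups, `I_e ≅ Ẑ^Σ × Ẑ^Σ`"; "if `e` abuts to vertices `v, v'`, then [for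
appropriate choices of conjugates] we have inclusions `I_v, I_{v'} ⊆ I_e`, and the natural morphism
`I_v × I_{v'} → I_e` is an open injective homomorphism, with image of index equal to `i^Σ_e`."
[cite: MochizukiAbsTopII2013, Prop 1.3 (ii) p.11] -/
def Prop_1_3_ii : Prop :=
  ∀ e : X.Node,
    (X.nodeSub e ≤ X.IvNode e ∧ X.IvNode e ⊓ X.PiG = X.nodeSub e ∧ X.IvNode e ⊔ X.PiG = X.PiI) ∧
    (∃ A B : Subgroup X.PiH, IsClosed (A : Set X.PiH) ∧ IsClosed (B : Set X.PiH) ∧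
      IsFreeProSigmaCyclic X.Sigma A ∧ IsFreeProSigmaCyclic X.Sigma B ∧
      IsInternalProduct A B (X.IvNode e)) ∧
    ∀ v v' : X.Vert, X.nodeAbuts e v → X.nodeAbuts e v' →
      ∃ g g' : X.PiH, ∃ J : Subgroup X.PiH,
        IsInternalProduct (MulAut.conj g • X.Iv v) (MulAut.conj g' • X.Iv v') J ∧
        J ≤ X.IvNode e ∧ IsOpen ((J.subgroupOf (X.IvNode e) : Subgroup ↥(X.IvNode e)) :
          Set ↥(X.IvNode e)) ∧
        J.relIndex (X.IvNode e) = X.sigmaIndex e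

/-- **Prop 1.3 (iii)** p. 11, the clauses not in `DPSCData.Prop13iii` (vertex `v`; cusp `e`
abutting to `v`): "`D_v ∩ Π_I = I_v × Π_v`; as abstract profinite groups, `I_v ≅ Ẑ^Σ`. If `e` is a
cusp that abuts to `v`, then [for appropriate choices of conjugates] we have inclusions
`I_e, I_v ⊆ D_e ∩ Π_I`, and the natural morphism `I_e × I_v → D_e ∩ Π_I` is an isomorphism; in
particular, [...] `D_e ∩ Π_I ≅ Ẑ^Σ × Ẑ^Σ`, and we have a natural exact sequence
`1 → I_e → D_e ∩ Π_I → I → 1`" (`I_e = (D_e ∩ Π_I) ∩ Π_𝔾`, `(D_e ∩ Π_I) · Π_𝔾 = Π_I`).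
[cite: MochizukiAbsTopII2013, Prop 1.3 (iii) p.11] -/
def Prop_1_3_iii' : Prop :=
  (∀ v : X.Vert, IsInternalProduct (X.Iv v) (X.vertSub v) (X.Dv v ⊓ X.PiI) ∧
    IsFreeProSigmaCyclic X.Sigma ↥(X.Iv v)) ∧
  ∀ e : X.Cusp, ∃ g : X.PiH,
    IsInternalProduct (X.IvCusp e) (MulAut.conj g • X.Iv (X.cuspVert e)) (X.DvCusp e ⊓ X.PiI) ∧
    (X.DvCusp e ⊓ X.PiI) ⊓ X.PiG = X.IvCusp e ∧ (X.DvCusp e ⊓ X.PiI) ⊔ X.PiG = X.PiI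

/-- **Prop 1.3 (v)** p. 12, middle clause (not in `DPSCData.Prop13v`): "`D_v ∩ Π_I = C_{Π_I}(I_v)
= N_{Π_I}(I_v) = Z_{Π_I}(I_v)` is commensurably terminal in `Π_I`" — commensurator, normalizer and
centralizer taken inside `Π_I`. [cite: MochizukiAbsTopII2013, Prop 1.3 (v) p.12] -/
def Prop_1_3_v' : Prop :=
  ∀ v : X.Vert,
    (X.Dv v ⊓ X.PiI).subgroupOf X.PiI =
        Subgroup.Commensurable.commensurator ((X.Iv v).subgroupOf X.PiI) ∧
      (X.Dv v ⊓ X.PiI).subgroupOf X.PiI =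
        Subgroup.normalizer (((X.Iv v).subgroupOf X.PiI : Subgroup ↥X.PiI) : Set ↥X.PiI) ∧
      (X.Dv v ⊓ X.PiI).subgroupOf X.PiI =
        Subgroup.centralizer (((X.Iv v).subgroupOf X.PiI : Subgroup ↥X.PiI) : Set ↥X.PiI) ∧
      IsCommensurablyTerminal ((X.Dv v ⊓ X.PiI).subgroupOf X.PiI)

/-! ### Edges = nodes ⊔ cusps (for (viii) and (x)) -/

/-- The edges of `𝔾`: nodes and cusps (Ex 1.1 (ii) p. 9: "the edge-like subgroups `Π_e` may be
either nodal or cuspidal"). [cite: MochizukiAbsTopII2013, Ex 1.1 (ii) p.9] -/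
abbrev Edge : Type u := X.Node ⊕ X.Cusp

/-- The decomposition group `D_e` of an edge. [cite: MochizukiAbsTopII2013, Def 1.2 (ii) p.10] -/
def DEdge : X.Edge → Subgroup X.PiH
  | Sum.inl e => X.DvNode e
  | Sum.inr e => X.DvCusp e

/-- The inertia group `I_e` of an edge (`Z_{Π_I}(Π_e)` for a node, `Π_e` for a cusp).
[cite: MochizukiAbsTopII2013, Def 1.2 (ii) p.10] -/
def IEdge : X.Edge → Subgroup X.PiH
  | Sum.inl e => X.IvNode e
  | Sum.inr e => X.IvCusp e

/-- "the edge `e` abuts to the vertex `v`". [cite: MochizukiAbsTopII2013, Ex 1.1 (ii) p.9] -/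
def EdgeAbuts : X.Edge → X.Vert → Prop
  | Sum.inl e, v => X.nodeAbuts e v
  | Sum.inr e, v => X.cuspVert e = v

/-- **Prop 1.3 (viii)** p. 12: "Let `e, e'` be edges of `𝔾`. If `D_e ∩ D_{e'} ∩ Π_I ≠ {1}`, then one
of the following two [mutually exclusive] properties holds: (1) `e = e'`; (2) `e` and `e'` are
distinct, but abut to the same vertex `v`, and `D_e ∩ D_{e'} ∩ Π_𝔾 = {1}`. Moreover, in the
situation of (2), [for appropriate choices of conjugates] we have `I_v = D_e ∩ D_{e'} ∩ Π_I`."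
(Typed for every `Π_H`-conjugate of the chosen `D_{e'}`.)  NOTE (erratum E-L4-9, 2026-08-26): this
`Π_H`-scope form is TOO STRONG — print fixes `D_e` only up to `Π_𝔾`-conjugacy (Def 1.2 (ii) p. 10) and
the form fails when the outer `H`-action moves edges (kernel certificates
`AbsTopII/Prop13ConjugacyScope.lean`, p425481); SUPERSEDED for consumers by `Prop_1_3_viii'`
(`AbsTopII/InertiaGroupsScope.lean`). [cite: MochizukiAbsTopII2013, Prop 1.3 (viii) p.12] -/
def Prop_1_3_viii : Prop :=
  ∀ (e e' : X.Edge) (g : X.PiH), X.DEdge e ⊓ MulAut.conj g • X.DEdge e' ⊓ X.PiI ≠ ⊥ →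
    e = e' ∨
      (e ≠ e' ∧ ∃ v : X.Vert, X.EdgeAbuts e v ∧ X.EdgeAbuts e' v ∧
        X.DEdge e ⊓ MulAut.conj g • X.DEdge e' ⊓ X.PiG = ⊥ ∧
        ∃ h : X.PiH, MulAut.conj h • X.Iv v = X.DEdge e ⊓ MulAut.conj g • X.DEdge e' ⊓ X.PiI)

/-! ### Log points (Prop 1.3 (x)) -/

/-- The possible images of a log point `τ_S ∈ X^{log}(S^{log})` in `X`: a cusp, a non-nodal
(non-cuspidal) point of the irreducible component `v`, or a node (Prop 1.3 (x) p. 12).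
[cite: MochizukiAbsTopII2013, Prop 1.3 (x) p.12] -/
inductive PointKind (V N C : Type u) : Type u
  /-- "the image of `τ_S` is the cusp `e`" -/
  | cusp (e : C)
  /-- "the image of `τ_S` is a non-nodal point of the irreducible component corresponding to `v`"
  (and not a cusp) -/
  | smooth (v : V)
  /-- "the image of `τ_S` is the node corresponding to `e`" -/
  | node (e : N)

/-- A log point of the stable log curve, through its group-theoretic shadow: "`τ_I : I → Π_I` the
[outer] homomorphism that arises [by functoriality!] from a 'log point' `τ_S ∈ X^{log}(S^{log})`"
(Prop 1.3 (x) p. 12), recorded by the IMAGE `τ_I(I) ⊆ Π_I` (a closed subgroup mapping onto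
`I = Π_I/Π_𝔾` and meeting `Π_𝔾` trivially — a splitting), up to `Π_H`-conjugacy, together with
the kind of the image point of `τ_S`. [cite: MochizukiAbsTopII2013, Prop 1.3 (x) p.12] -/
structure LogPointData where
  /-- `τ_I(I) ⊆ Π_H` -/
  image : Subgroup X.PiH
  /-- `τ_I(I) ⊆ Π_I` -/
  image_le : image ≤ X.PiI
  /-- `τ_I(I)` is closed -/
  isClosed_image : IsClosed (image : Set X.PiH)
  /-- `τ_I(I) ∩ Π_𝔾 = 1` -/
  image_inf : image ⊓ X.PiG = ⊥
  /-- `τ_I(I) · Π_𝔾 = Π_I` (`τ_I` is a section of `Π_I ↠ I`) -/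
  image_sup : image ⊔ X.PiG = X.PiI
  /-- the image of `τ_S` in `X` -/
  kind : PointKind X.Vert X.Node X.Cusp

variable {X} in
/-- "`τ_I` is *non-verticial* if `τ_I(I)` is not contained in `I_v` for any vertex `v`" (any
conjugate). [cite: MochizukiAbsTopII2013, Prop 1.3 (x) p.12] -/
def LogPointData.IsNonVerticial (τ : X.LogPointData) : Prop :=
  ∀ (v : X.Vert) (g : X.PiH), ¬ τ.image ≤ MulAut.conj g • X.Iv v

variable {X} in
/-- "`τ_I` is *non-edge-like* if `τ_I(I)` is not contained in `I_e` for any edge `e`" (any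
conjugate). [cite: MochizukiAbsTopII2013, Prop 1.3 (x) p.12] -/
def LogPointData.IsNonEdgeLike (τ : X.LogPointData) : Prop :=
  ∀ (e : X.Edge) (g : X.PiH), ¬ τ.image ≤ MulAut.conj g • X.IEdge e

/-- **Prop 1.3 (x)** p. 12: "if `τ_I` is non-verticial and non-edge-like, then the image of `τ_S` is
the unique cusp `e_τ` of `X` such that [for an appropriate choice of conjugate of `D_{e_τ}`]
`τ_I(I) ⊆ D_{e_τ}`.  Now suppose that the image of `τ_S` is not a cusp. Then `τ_I` satisfies the
condition `τ_I(I) = I_{v_τ}` for some vertex `v_τ` [and an appropriate choice of conjugate] if and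
only if the image of `τ_S` is a non-nodal point of the irreducible component of `X` corresponding to
`v_τ`; `τ_I` is non-verticial and satisfies the condition `τ_I(I) ⊆ I_{e_τ}` for some node `e_τ`
[and an appropriate conjugate] if and only if the image of `τ_S` is the node of `X` corresponding
to `e_τ`."  NOTE (erratum E-L4-9, 2026-08-26): the `∃ g : Π_H` conjugates below are TOO PERMISSIVE —
print asks for appropriate `Π_𝔾`-conjugates (Def 1.2 (ii) p. 10); the typed uniqueness clause fails
when the outer `H`-action moves cusps (kernel certificate `not_prop_1_3_x_of_cusps_moved`,
`AbsTopII/Prop13ConjugacyScope.lean`, p425481); SUPERSEDED for consumers by `Prop_1_3_x'`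
(`AbsTopII/InertiaGroupsScope.lean`). [cite: MochizukiAbsTopII2013, Prop 1.3 (x) p.12] -/
def Prop_1_3_x : Prop :=
  ∀ τ : X.LogPointData,
    (τ.IsNonVerticial → τ.IsNonEdgeLike →
      ∃ e : X.Cusp, τ.kind = PointKind.cusp e ∧
        ∀ e' : X.Cusp, (∃ g : X.PiH, τ.image ≤ MulAut.conj g • X.DvCusp e') ↔ e' = e) ∧
    ((∀ e : X.Cusp, τ.kind ≠ PointKind.cusp e) →
      (∀ v : X.Vert, (∃ g : X.PiH, τ.image = MulAut.conj g • X.Iv v) ↔ τ.kind = PointKind.smooth v) ∧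
      (∀ e : X.Node, (τ.IsNonVerticial ∧ ∃ g : X.PiH, τ.image ≤ MulAut.conj g • X.IvNode e) ↔
        τ.kind = PointKind.node e))

/-! ### Elementary consequences (PROVED) -/

/-- In an internal direct product the factors are normalised by each other: `B ≤ N(A)`.
[cite: MochizukiAbsTopII2013, Prop 1.3 (iii) p.11] -/
theorem IsInternalProduct.right_le_normalizer {G : Type u} [Group G] {A B K : Subgroup G}
    (h : IsInternalProduct A B K) : B ≤ Subgroup.normalizer (A : Set G) := by
  intro b hb
  rw [Subgroup.mem_normalizer_iff]
  intro a
  constructor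
  · intro ha
    have := h.commute a ha b hb
    rw [show b * a * b⁻¹ = a by rw [← this, mul_inv_cancel_right]]
    exact ha
  · intro ha
    have hc := h.commute _ ha b hb
    -- `(b a b⁻¹) b = b (b a b⁻¹)` gives `b a = b (b a b⁻¹)`, i.e. `a = b a b⁻¹`
    have : a = b * a * b⁻¹ := by
      have h1 : b * a * b⁻¹ * b = b * a := by group
      rw [h1] at hc
      exact mul_left_cancel hc
    rw [this]
    exact ha

/-- Prop 1.3 (iii) (rest) recovers the first clause typed by abc-iut-L4-t4 (`DPSCData.Prop13iii`:
`I_v ∩ Π_𝔾 = 1` and `I_v · Π_𝔾 = Π_I`), granted `D_v ∩ Π_𝔾 = Π_v` (Prop 1.3 (v)): consistency of the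
two files' renderings. [cite: MochizukiAbsTopII2013, Prop 1.3 (iii) p.11] -/
theorem Prop_1_3_iii'_inf_eq_bot (h : X.Prop_1_3_iii') (v : X.Vert)
    (hv : X.Dv v ⊓ X.PiG = X.vertSub v) : X.Iv v ⊓ X.PiG = ⊥ := by
  obtain ⟨hprod, -⟩ := h.1 v
  have hle : X.Iv v ⊓ X.PiG ≤ X.Iv v ⊓ X.vertSub v := by
    rw [← hv]
    exact le_inf inf_le_left (le_inf (le_trans inf_le_left (le_trans hprod.left_le inf_le_left))
      inf_le_right)
  rw [eq_bot_iff, ← hprod.inf_eq_bot]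
  exact hle

end DPSCIndexData

end Literature.AnabelianGeometry.AbsoluteAnabelian.AbsTopII
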